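/-
Copyright (c) 2026. All rights reserved.
Released under Apache 2.0 license as described in the file LICENSE.
-/
import Literature.NumberTheory.LFunctions.NymanBeurlingBaezDuarteProofs

/-!
# Mass-zero Beurling step approximants under RH (THEOREM N(a), analytic core)

`HANDOFF/prove-1` gen14, ATTEMPT-21 §8.5 (the Lean blueprint of THEOREM N(a)). THEOREM N(b)
(`riemannHypothesis_of_latticeTail_fibre`, `Theorems/HandoffLatticeNymanRH.lean`) is the
RH-yielding half of the fibre form of Nyman–Beurling in the lattice-sum coordinates; the converse
N(a) («RH ⟹ the fibrewise infimum of the lattice tail is 0») needs, besides finite bookkeeping,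
exactly one analytic input, proved here from the tree's Báez-Duarte theorem
(`Literature.NumberTheory.LFunctions.baezDuarte_iff_holds`):

* `exists_natural_approx_of_riemannHypothesis` — under RH, for every `ε > 0` some natural
  Beurling combination `Σ_{k<N} a_k {1/((k+1)x)}` has constant `|Σ a_k/(k+1)| ≤ ε` and
  `∫_{(0,1]} (1 - Σ_k a_k {(1/(k+1))/x})² dx ≤ ε²` (the `L²(1,∞)` tail and the `L²(0,1]` part of
  Báez-Duarte's `‖χ - f‖_{L²(0,∞)} < ε`, written as real integrals);
* `exists_massZero_approx_one_of_riemannHypothesis` — under RH, `1_{(0,1]}` is approximated in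
  `L²(0,1]` by MASS-ZERO combinations `Σ_k c_k {β_k/x}`, `0 < β_k ≤ 1`, `Σ_k c_k β_k = 0`
  (subtract `C·{1/x}`, `C = Σ a_k/(k+1)`, `|C| ≤ ε`);
* `exists_massZero_approx_of_riemannHypothesis` — Beurling's dilation step: the same for every
  `1_{(0,a]}`, `0 < a ≤ 1`, with `0 < β_k ≤ a` (a mass-zero combination with `β_k ≤ 1` vanishes
  beyond `1`, so dilating by `a` scales the squared error by `a`).

Mass zero is what makes the dilated approximants live INSIDE the inner region of the fibre
(`b = β/2 ≤ a/2`), and is the form in which the successor assembles the completion of the window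
datum `1_{(1/2,1]}` (blueprint: `-ρ_1 + Σ_{n ≤ M} (T_{2/(2n+1)} D₀ - T_{1/(n+1)} D₀)`).
Nothing here bears on the truth of RH: every statement is conditional on `RiemannHypothesis`.
-/

noncomputable section

set_option linter.dupNamespace false

open MeasureTheory Set Filter
open scoped ENNReal

namespace Summit.RiemannHypothesis.RiemannHypothesis.Theorems

namespace LatticeUncertainty

/-- A finite Beurling combination `x ↦ Σ_k c_k {β_k/x}` is measurable. -/
theorem measurable_beurlingSum {N : ℕ} (c β : Fin N → ℝ) :
    Measurable fun x : ℝ ↦ ∑ k, c k * Int.fract (β k / x) := by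
  refine Finset.measurable_sum _ fun k _ ↦ ?_
  exact measurable_const.mul (measurable_fract.comp (measurable_const.div measurable_id))

/-- `‖Σ_k c_k {β_k/x}‖ ≤ Σ_k |c_k|` (each fractional part lies in `[0,1)`). -/
theorem norm_beurlingSum_le {N : ℕ} (c β : Fin N → ℝ) (x : ℝ) :
    ‖∑ k, c k * Int.fract (β k / x)‖ ≤ ∑ k, |c k| := by
  refine (norm_sum_le _ _).trans (Finset.sum_le_sum fun k _ ↦ ?_)
  rw [norm_mul, Real.norm_eq_abs, Real.norm_eq_abs, abs_of_nonneg (Int.fract_nonneg (β k / x))]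
  calc |c k| * Int.fract (β k / x) ≤ |c k| * 1 := by
        gcongr
        exact (Int.fract_lt_one _).le
    _ = |c k| := mul_one _

/-- The squared defect `(1_{(0,a]}(x) - Σ_k c_k {β_k/x})²` is bounded by `(1 + Σ_k |c_k|)²`. -/
theorem norm_defect_sq_le {N : ℕ} (a : ℝ) (c β : Fin N → ℝ) (x : ℝ) :
    ‖((Ioc 0 a).indicator 1 x - ∑ k, c k * Int.fract (β k / x)) ^ 2‖ ≤ (1 + ∑ k, |c k|) ^ 2 := by
  rw [norm_pow]
  refine pow_le_pow_left₀ (norm_nonneg _) ?_ 2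
  refine (norm_sub_le _ _).trans (add_le_add ?_ (norm_beurlingSum_le c β x))
  by_cases hx : x ∈ Ioc 0 a
  · simp [indicator_of_mem hx]
  · simp [indicator_of_notMem hx]

/-- The squared defect is integrable on every `(0, T]`. -/
theorem integrableOn_defect_sq {N : ℕ} (a : ℝ) (c β : Fin N → ℝ) (T : ℝ) :
    IntegrableOn (fun x : ℝ ↦ ((Ioc 0 a).indicator 1 x - ∑ k, c k * Int.fract (β k / x)) ^ 2)
      (Ioc 0 T) := by
  have hmeas : Measurable fun x : ℝ ↦
      ((Ioc 0 a).indicator 1 x - ∑ k, c k * Int.fract (β k / x)) ^ 2 :=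
    ((measurable_one.indicator measurableSet_Ioc).sub (measurable_beurlingSum c β)).pow_const 2
  exact Measure.integrableOn_of_bounded (by simp) hmeas.aestronglyMeasurable
    (Eventually.of_forall fun x ↦ norm_defect_sq_le a c β x)

/-- **Step 1 (extraction from Báez-Duarte).** Under RH, for every `ε > 0` there is a natural
Beurling combination `f = Σ_{k<N} a_k {1/((k+1)x)}` with `|Σ_k a_k/(k+1)| ≤ ε` and
`∫_{(0,1]} (1 - Σ_k a_k {(1/(k+1))/x})² dx ≤ ε²`: from `‖1_{(0,1]} - f‖_{L²(0,∞)} < ε`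
(`baezDuarte_iff_holds`), on `(1,∞)` one has `f = C/x`, `C = Σ a_k/(k+1)`, `‖1/x‖_{L²(1,∞)} = 1`,
and the `(0,1]` part of the squared norm is at most the whole. [cite: BaezDuarte2003, Thm. 1.1] -/
theorem exists_natural_approx_of_riemannHypothesis (hRH : RiemannHypothesis) {ε : ℝ}
    (hε : 0 < ε) :
    ∃ (N : ℕ) (a : Fin N → ℝ), |∑ k, a k / ((k : ℕ) + 1)| ≤ ε ∧
      ∫ x in Ioc (0 : ℝ) 1, (1 - ∑ k, a k * Int.fract ((1 / ((k : ℕ) + 1 : ℝ)) / x)) ^ 2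
        ≤ ε ^ 2 := by
  obtain ⟨N, c, hN⟩ := Literature.NumberTheory.LFunctions.baezDuarte_iff_holds.1 hRH ε hε
  -- the function `D = χ - f` of Báez-Duarte's statement
  set D : ℝ → ℝ := fun x ↦ (Ioc (0 : ℝ) 1).indicator 1 x -
      ∑ k : Fin N, c k * Int.fract (1 / (((k : ℕ) + 1 : ℝ) * x)) with hD
  have hDm : Measurable D := by
    refine (measurable_one.indicator measurableSet_Ioc).sub (Finset.measurable_sum _ fun k _ ↦ ?_)
    exact measurable_const.mul (measurable_fract.comp (by fun_prop))
  refine ⟨N, c, ?_, ?_⟩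
  · -- (i) the tail `x > 1` gives `|C| ≤ ε` (as in the tree's
    -- `riemannHypothesis_of_beurling_closure`)
    set C : ℝ := ∑ k, c k / ((k : ℕ) + 1) with hC
    have hDtail : ∀ x : ℝ, 1 < x → D x = -C * x⁻¹ := by
      intro x hx
      have hx0 : 0 < x := by linarith
      have hxm : x ∉ Ioc (0 : ℝ) 1 := fun h' ↦ absurd h'.2 (not_le.2 hx)
      simp only [hD, indicator_of_notMem hxm, zero_sub, hC, neg_mul, Finset.sum_mul, neg_inj]
      refine Finset.sum_congr rfl fun k _ ↦ ?_
      have hk : (0 : ℝ) < (k : ℕ) + 1 := by positivity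
      rw [Int.fract_eq_self.2 ⟨by positivity, ?_⟩]
      · field_simp
      · rw [div_lt_one (by positivity)]; nlinarith
    have h1 : eLpNorm D 2 (volume.restrict (Ioi 1)) < ENNReal.ofReal ε :=
      (eLpNorm_mono_measure D
        (Measure.restrict_mono_set _ (Ioi_subset_Ioi zero_le_one))).trans_lt hN
    have h2 : eLpNorm D 2 (volume.restrict (Ioi 1)) =
        eLpNorm ((-C) • fun x : ℝ ↦ x⁻¹) 2 (volume.restrict (Ioi 1)) := by
      refine eLpNorm_congr_ae ?_
      filter_upwards [ae_restrict_mem measurableSet_Ioi] with x hx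
      rw [hDtail x hx, Pi.smul_apply, smul_eq_mul]
    rw [h2, eLpNorm_const_smul, Literature.NumberTheory.LFunctions.eLpNorm_inv_Ioi_one, mul_one,
      enorm_neg, Real.enorm_eq_ofReal_abs, ENNReal.ofReal_lt_ofReal_iff hε] at h1
    exact h1.le
  · -- (ii) the `(0,1]` part of the squared `L²` norm is at most `ε²`
    have hmem : MemLp D 2 (volume.restrict (Ioi 0)) :=
      ⟨hDm.aestronglyMeasurable, hN.trans ENNReal.ofReal_lt_top⟩
    have hint : IntegrableOn (fun x ↦ D x ^ 2) (Ioi 0) :=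
      (memLp_two_iff_integrable_sq hDm.aestronglyMeasurable).1 hmem
    have hlt : ∫⁻ x in Ioi (0 : ℝ), ‖D x‖ₑ ^ (2 : ℝ) < ENNReal.ofReal ε ^ 2 := by
      rw [eLpNorm_eq_lintegral_rpow_enorm_toReal (by norm_num) (by norm_num)] at hN
      simp only [ENNReal.toReal_ofNat, one_div] at hN
      have h := ENNReal.rpow_lt_rpow hN (show (0 : ℝ) < 2 by norm_num)
      rwa [← ENNReal.rpow_mul, inv_mul_cancel₀ two_ne_zero, ENNReal.rpow_one,
        ENNReal.rpow_two] at h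
    have hI : ∫ x in Ioi (0 : ℝ), D x ^ 2 ≤ ε ^ 2 := by
      rw [integral_eq_lintegral_of_nonneg_ae (Eventually.of_forall fun x ↦ sq_nonneg _)
        (hDm.pow_const 2).aestronglyMeasurable]
      have heq : ∫⁻ x in Ioi (0 : ℝ), ENNReal.ofReal (D x ^ 2)
          = ∫⁻ x in Ioi (0 : ℝ), ‖D x‖ₑ ^ (2 : ℝ) := by
        refine lintegral_congr fun x ↦ ?_
        rw [Real.enorm_eq_ofReal_abs, ENNReal.ofReal_rpow_of_nonneg (abs_nonneg _) (by norm_num),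
          Real.rpow_two, sq_abs]
      rw [heq]
      calc (∫⁻ x in Ioi (0 : ℝ), ‖D x‖ₑ ^ (2 : ℝ)).toReal
          ≤ (ENNReal.ofReal ε ^ 2).toReal :=
            ENNReal.toReal_mono (ENNReal.pow_ne_top ENNReal.ofReal_ne_top) hlt.le
        _ = ε ^ 2 := by rw [ENNReal.toReal_pow, ENNReal.toReal_ofReal hε.le]
    calc ∫ x in Ioc (0 : ℝ) 1, (1 - ∑ k, c k * Int.fract ((1 / ((k : ℕ) + 1 : ℝ)) / x)) ^ 2
        = ∫ x in Ioc (0 : ℝ) 1, D x ^ 2 := by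
          refine setIntegral_congr_fun measurableSet_Ioc fun x hx ↦ ?_
          simp only [hD, indicator_of_mem hx, Pi.one_apply, div_div]
      _ ≤ ∫ x in Ioi (0 : ℝ), D x ^ 2 :=
          setIntegral_mono_set hint (Eventually.of_forall fun x ↦ sq_nonneg _)
            Ioc_subset_Ioi_self.eventuallyLE
      _ ≤ ε ^ 2 := hI

/-- **Step 2 (mass zero at `a = 1`).** Under RH, for every `ε > 0` there is a finite Beurling
combination `Σ_k c_k {β_k/x}` with `0 < β_k ≤ 1` and `Σ_k c_k β_k = 0` such that
`∫_{(0,1]} (1 - Σ_k c_k {β_k/x})² dx ≤ ε`: append `-C·{1/x}` (`C = Σ a_k/(k+1)`, `|C| ≤ ε'`) to the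
natural approximant of Step 1 and use `(p + q)² ≤ 2p² + 2q²`, `{1/x}² ≤ 1`. -/
theorem exists_massZero_approx_one_of_riemannHypothesis (hRH : RiemannHypothesis) {ε : ℝ}
    (hε : 0 < ε) :
    ∃ (N : ℕ) (c β : Fin N → ℝ), (∀ k, 0 < β k ∧ β k ≤ 1) ∧ ∑ k, c k * β k = 0 ∧
      ∫ x in Ioc (0 : ℝ) 1, (1 - ∑ k, c k * Int.fract (β k / x)) ^ 2 ≤ ε := by
  set ε' : ℝ := min (1 / 2) (ε / 4) with hε'
  have hε'0 : 0 < ε' := lt_min (by norm_num) (by linarith)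
  have hε'1 : ε' ≤ 1 / 2 := min_le_left _ _
  have hε'2 : ε' ≤ ε / 4 := min_le_right _ _
  obtain ⟨N, a, hC, hI⟩ := exists_natural_approx_of_riemannHypothesis hRH hε'0
  set C : ℝ := ∑ k, a k / ((k : ℕ) + 1) with hCdef
  set S : ℝ → ℝ := fun x ↦ ∑ k, a k * Int.fract ((1 / ((k : ℕ) + 1 : ℝ)) / x) with hS
  refine ⟨N + 1, Fin.snoc a (-C), Fin.snoc (fun k : Fin N ↦ 1 / ((k : ℕ) + 1 : ℝ)) 1, ?_, ?_, ?_⟩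
  · intro k
    refine Fin.lastCases ?_ (fun i ↦ ?_) k
    · simp
    · simp only [Fin.snoc_castSucc]
      refine ⟨by positivity, ?_⟩
      rw [div_le_one (by positivity)]
      linarith [(i : ℕ).cast_nonneg (α := ℝ)]
  · rw [Fin.sum_univ_castSucc]
    simp only [Fin.snoc_castSucc, Fin.snoc_last, mul_one, hCdef]
    rw [add_neg_eq_zero]
    exact Finset.sum_congr rfl fun k _ ↦ by rw [mul_one_div]
  · -- the combination is `S x + (-C)·{1/x}`; pointwise: `(1 - (S + (-C) f))² ≤ 2 (1 - S)² + 2 C²`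
    have hpt : ∀ x : ℝ,
        (1 - (S x + -C * Int.fract (1 / x))) ^ 2 ≤ 2 * (1 - S x) ^ 2 + 2 * C ^ 2 := by
      intro x
      have hf0 : 0 ≤ Int.fract (1 / x) := Int.fract_nonneg _
      have hf1 : Int.fract (1 / x) < 1 := Int.fract_lt_one _
      nlinarith [sq_nonneg (1 - S x - C * Int.fract (1 / x)), sq_nonneg C, hf0,
        mul_nonneg (sq_nonneg C) (sub_nonneg.2 hf1.le), mul_nonneg hf0 (sub_nonneg.2 hf1.le)]
    -- integrability of the dominating function on `(0,1]`
    have hS1 : IntegrableOn (fun x : ℝ ↦ (1 - S x) ^ 2) (Ioc 0 1) := by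
      refine (integrableOn_defect_sq 1 a (fun k : Fin N ↦ 1 / ((k : ℕ) + 1 : ℝ)) 1).congr_fun
        (fun x hx ↦ ?_) measurableSet_Ioc
      simp only [indicator_of_mem hx, Pi.one_apply, hS]
    have hdom : IntegrableOn (fun x : ℝ ↦ 2 * (1 - S x) ^ 2 + 2 * C ^ 2) (Ioc 0 1) :=
      (hS1.const_mul 2).add (integrableOn_const (by simp))
    have hvol : volume.real (Ioc (0 : ℝ) 1) = 1 := by rw [measureReal_def]; simp
    have hC2 : C ^ 2 ≤ ε' ^ 2 := by
      rw [← sq_abs]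
      exact pow_le_pow_left₀ (abs_nonneg C) hC 2
    have hI' : ∫ x in Ioc (0 : ℝ) 1, (1 - S x) ^ 2 ≤ ε' ^ 2 := hI
    have key : ∫ x in Ioc (0 : ℝ) 1, (1 - (S x + -C * Int.fract (1 / x))) ^ 2 ≤ ε := by
      calc ∫ x in Ioc (0 : ℝ) 1, (1 - (S x + -C * Int.fract (1 / x))) ^ 2
          ≤ ∫ x in Ioc (0 : ℝ) 1, (2 * (1 - S x) ^ 2 + 2 * C ^ 2) :=
            integral_mono_of_nonneg (Eventually.of_forall fun x ↦ sq_nonneg _) hdom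
              (Eventually.of_forall hpt)
        _ = (2 * ∫ x in Ioc (0 : ℝ) 1, (1 - S x) ^ 2) + 2 * C ^ 2 := by
            rw [integral_add (hS1.const_mul 2) (integrableOn_const (by simp)), integral_const_mul,
              setIntegral_const, hvol, one_smul]
        _ ≤ 2 * ε' ^ 2 + 2 * ε' ^ 2 := by linarith [hI', hC2]
        _ ≤ ε := by nlinarith [mul_nonneg hε'0.le (sub_nonneg.2 hε'1)]
    refine (le_of_eq ?_).trans key
    congr 1
    ext x
    rw [Fin.sum_univ_castSucc]
    simp only [Fin.snoc_castSucc, Fin.snoc_last, hS]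

/-- **Step 3 (Beurling's dilation step).** Under RH, for every `0 < a ≤ 1` and `ε > 0` there is a
finite mass-zero Beurling combination `Σ_k c_k {β_k/x}` with `0 < β_k ≤ a`, `Σ_k c_k β_k = 0` and
`∫_{(0,1]} (1_{(0,a]}(x) - Σ_k c_k {β_k/x})² dx ≤ ε`. Proof: a mass-zero combination `ψ` with
`β_k ≤ 1` satisfies `ψ(y) = Σ c_k β_k / y = 0` for `y > 1`, so with `P = 1_{(0,1]} - ψ` from Step 2,
`∫_{(0,1]} P(x/a)² dx ≤ ∫_0^∞ P(x/a)² dx = a ∫_0^∞ P² = a ∫_{(0,1]} P² ≤ a ε ≤ ε`. -/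
theorem exists_massZero_approx_of_riemannHypothesis (hRH : RiemannHypothesis) {a : ℝ}
    (ha0 : 0 < a) (ha1 : a ≤ 1) {ε : ℝ} (hε : 0 < ε) :
    ∃ (N : ℕ) (c β : Fin N → ℝ), (∀ k, 0 < β k ∧ β k ≤ a) ∧ ∑ k, c k * β k = 0 ∧
      ∫ x in Ioc (0 : ℝ) 1, ((Ioc 0 a).indicator 1 x - ∑ k, c k * Int.fract (β k / x)) ^ 2
        ≤ ε := by
  obtain ⟨N, c, β, hβ, hmass, hI⟩ := exists_massZero_approx_one_of_riemannHypothesis hRH hε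
  refine ⟨N, c, fun k ↦ a * β k, fun k ↦ ⟨mul_pos ha0 (hβ k).1, ?_⟩, ?_, ?_⟩
  · calc a * β k ≤ a * 1 := by gcongr; exact (hβ k).2
      _ = a := mul_one a
  · calc ∑ k, c k * (a * β k) = a * ∑ k, c k * β k := by
          rw [Finset.mul_sum]
          exact Finset.sum_congr rfl fun k _ ↦ by ring
      _ = 0 := by rw [hmass, mul_zero]
  · -- `P = 1_{(0,1]} - ψ` vanishes beyond `1`
    set P : ℝ → ℝ := fun y ↦ (Ioc (0 : ℝ) 1).indicator 1 y - ∑ k, c k * Int.fract (β k / y)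
      with hP
    have hPm : Measurable P :=
      (measurable_one.indicator measurableSet_Ioc).sub (measurable_beurlingSum c β)
    have hP0 : ∀ y : ℝ, 1 < y → P y = 0 := by
      intro y hy
      have hy0 : 0 < y := by linarith
      have hmem : y ∉ Ioc (0 : ℝ) 1 := fun h ↦ absurd h.2 (not_le.2 hy)
      have hfr : ∀ k, Int.fract (β k / y) = β k / y := fun k ↦
        Int.fract_eq_self.2 ⟨div_nonneg (hβ k).1.le hy0.le,
          by rw [div_lt_one hy0]; linarith [(hβ k).2]⟩
      simp only [hP, indicator_of_notMem hmem, zero_sub, neg_eq_zero, hfr]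
      simp_rw [← mul_div_assoc]
      rw [← Finset.sum_div, hmass, zero_div]
    -- the integrand is `P(x/a)²`
    have hresc : ∀ x : ℝ, ((Ioc 0 a).indicator 1 x - ∑ k, c k * Int.fract (a * β k / x)) ^ 2
        = P (x / a) ^ 2 := by
      intro x
      have hind : (Ioc 0 a).indicator (1 : ℝ → ℝ) x = (Ioc (0 : ℝ) 1).indicator 1 (x / a) := by
        by_cases hx : x ∈ Ioc 0 a
        · have hx' : x / a ∈ Ioc (0 : ℝ) 1 := ⟨div_pos hx.1 ha0, (div_le_one ha0).2 hx.2⟩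
          rw [indicator_of_mem hx, indicator_of_mem hx']
          rfl
        · have hx' : x / a ∉ Ioc (0 : ℝ) 1 := fun h ↦
            hx ⟨(div_pos_iff_of_pos_right ha0).1 h.1, (div_le_one ha0).1 h.2⟩
          rw [indicator_of_notMem hx, indicator_of_notMem hx']
      have hfr : ∀ k, Int.fract (a * β k / x) = Int.fract (β k / (x / a)) := by
        intro k
        rw [div_div_eq_mul_div, mul_comm (β k) a]
      simp only [hP, hind, hfr]
    -- integrability of `x ↦ P(x/a)²` on `(0,∞)`: bounded on `(0,a]`, zero beyond `a`
    have hga : IntegrableOn (fun x : ℝ ↦ P (x / a) ^ 2) (Ioi 0) := by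
      have hgm : Measurable fun x : ℝ ↦ P (x / a) ^ 2 :=
        (hPm.comp (measurable_id.div_const a)).pow_const 2
      have h1 : IntegrableOn (fun x : ℝ ↦ P (x / a) ^ 2) (Ioc 0 a) :=
        Measure.integrableOn_of_bounded (by simp) hgm.aestronglyMeasurable
          (Eventually.of_forall fun x ↦ norm_defect_sq_le 1 c β (x / a))
      have h2 : IntegrableOn (fun x : ℝ ↦ P (x / a) ^ 2) (Ioi a) := by
        refine integrableOn_zero.congr_fun (fun x hx ↦ ?_) measurableSet_Ioi
        have hxa : 1 < x / a := (one_lt_div ha0).2 hx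
        simp only [hP0 (x / a) hxa, zero_pow two_ne_zero]
      refine (h1.union h2).mono_set fun x hx ↦ ?_
      rcases le_or_gt x a with h | h
      · exact Or.inl ⟨hx, h⟩
      · exact Or.inr h
    have hIP : ∫ y in Ioc (0 : ℝ) 1, P y ^ 2 ≤ ε := by
      calc ∫ y in Ioc (0 : ℝ) 1, P y ^ 2
          = ∫ y in Ioc (0 : ℝ) 1, (1 - ∑ k, c k * Int.fract (β k / y)) ^ 2 := by
            refine setIntegral_congr_fun measurableSet_Ioc fun y hy ↦ ?_
            simp only [hP, indicator_of_mem hy, Pi.one_apply]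
        _ ≤ ε := hI
    calc ∫ x in Ioc (0 : ℝ) 1, ((Ioc 0 a).indicator 1 x - ∑ k, c k * Int.fract (a * β k / x)) ^ 2
        = ∫ x in Ioc (0 : ℝ) 1, P (x / a) ^ 2 :=
          setIntegral_congr_fun measurableSet_Ioc fun x _ ↦ hresc x
      _ ≤ ∫ x in Ioi (0 : ℝ), P (x / a) ^ 2 :=
          setIntegral_mono_set hga (Eventually.of_forall fun x ↦ sq_nonneg _)
            Ioc_subset_Ioi_self.eventuallyLE
      _ = a * ∫ y in Ioi (0 : ℝ), P y ^ 2 := by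
          have h := integral_comp_mul_left_Ioi (fun y : ℝ ↦ P y ^ 2) 0 (inv_pos.2 ha0)
          simp only [mul_zero, inv_inv, smul_eq_mul] at h
          simp_rw [div_eq_inv_mul]
          exact h
      _ = a * ∫ y in Ioc (0 : ℝ) 1, P y ^ 2 := by
          rw [setIntegral_eq_of_subset_of_forall_sdiff_eq_zero measurableSet_Ioi
            Ioc_subset_Ioi_self fun y hy ↦ ?_]
          have hy1 : 1 < y := by
            rcases hy with ⟨hy0, hy'⟩
            by_contra h
            exact hy' ⟨hy0, not_lt.1 h⟩
          simp only [hP0 y hy1, zero_pow two_ne_zero]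
      _ ≤ a * ε := by gcongr
      _ ≤ ε := by nlinarith

end LatticeUncertainty

end Summit.RiemannHypothesis.RiemannHypothesis.Theorems

end
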